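import Literature.Analysis.FluidPDE.MVRelativeEnergyPointwiseBounds
import HarnessLib

/-!
# The uniform pointwise relative-energy inequality (Březina–Feireisl 2018, (3.9)–(3.11))

Assembly of `MVRelativeEnergyPointwiseBounds` with the compactness constants of
`BallisticFreeEnergyCoercivity` and `ThermoLinearization`: for an equation of state as in
`MVWeakStrongUniqueness.brezinaFeireisl2018_thm_3_3` (Gibbs, thermodynamic stability, `C²`,
`e > 0`, growth (3.1)), a compact set `K ⊂ (0,∞)²` of reference states and a bound `M` on the
strong data, there are `δ > 0`, cut-off levels `a < b` and `C > 0` such that for all strong point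
data with `(r,Θ) ∈ K`, bounded by `M` and satisfying the continuity and temperature equations, and
for every state `(ρ,E,m)` with `ρ > 0`, `ϑ(ρ,E) > 0`:

`reducedRHS (clamp a b) ≤ C · relEnergyFull`  (`master_pointwise_inequality`),

and the cut-off is inactive (`a ≤ s ≤ b`) on the `δ`-boxes around `K`. Combined with
`rawRHS_add_div_eq` this is the integrand inequality behind BF (3.11).

## References

* J. Březina, E. Feireisl, J. Math. Soc. Japan 70 (2018), §3.2.2.
-/

noncomputable section

open Set Filter Function Metric
open scoped Topology BigOperators

namespace Literature.Analysis.FluidPDE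

namespace CompressibleEuler

open StrongPointData EulerEOS

variable {eos : EulerEOS}

/-- Maxwell's relation in the form used by `reducedRHS_le_essential`: `p_ϑ/r + r s_ρ = 0`.
[cite: FeireislNovotny2009, §1.4] -/
theorem maxwell_form (hG : eos.IsGibbs) (hp2 : ContDiffOn ℝ 2 (uncurry eos.p) (Set.Ioi 0 ×ˢ Set.Ioi 0))
    (he2 : ContDiffOn ℝ 2 (uncurry eos.e) (Set.Ioi 0 ×ˢ Set.Ioi 0))
    (hs2 : ContDiffOn ℝ 2 (uncurry eos.s) (Set.Ioi 0 ×ˢ Set.Ioi 0)) (d : StrongPointData) (hr : 0 < d.r)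
    (hΘ : 0 < d.Θ) : d.pϑ eos / d.r + d.r * deriv (fun x => eos.s x d.Θ) d.r = 0 := by
  rw [hG.maxwell hp2 he2 hs2 hr hΘ]
  unfold pϑ
  have hr' : d.r ≠ 0 := hr.ne'
  field_simp
  ring

/-- The temperature equation of the strong solution in entropy form, `p_ϑ divU + r s_ϑ DₜΘ = 0`
(from the internal-energy equation via Gibbs' relation and Maxwell's relation).
[cite: BrezinaFeireisl2018, (1.6)] -/
theorem tempEq_entropy_form (hG : eos.IsGibbs)
    (hp2 : ContDiffOn ℝ 2 (uncurry eos.p) (Set.Ioi 0 ×ˢ Set.Ioi 0))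
    (he2 : ContDiffOn ℝ 2 (uncurry eos.e) (Set.Ioi 0 ×ˢ Set.Ioi 0))
    (hs2 : ContDiffOn ℝ 2 (uncurry eos.s) (Set.Ioi 0 ×ˢ Set.Ioi 0)) (d : StrongPointData) (hr : 0 < d.r)
    (hΘ : 0 < d.Θ) (hT : d.TemperatureEq eos) :
    d.pϑ eos * d.divU + d.r * deriv (fun θ => eos.s d.r θ) d.Θ * d.DtΘ = 0 := by
  have hmax := hG.maxwell hp2 he2 hs2 hr hΘ
  have hgρ := hG.theta_mul_deriv_s_rho hr hΘ
  have hgϑ := hG.theta_mul_deriv_s_theta hr hΘ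
  unfold TemperatureEq at hT
  unfold pϑ
  have hr' : d.r ≠ 0 := hr.ne'
  have hΘ' : d.Θ ≠ 0 := hΘ.ne'
  -- `p - r² e_ρ = Θ p_ϑ`
  have h1 : eos.p d.r d.Θ - d.r ^ 2 * deriv (fun x => eos.e x d.Θ) d.r =
      d.Θ * deriv (fun θ => eos.p d.r θ) d.Θ := by
    have : deriv (fun x => eos.e x d.Θ) d.r =
        d.Θ * deriv (fun x => eos.s x d.Θ) d.r + eos.p d.r d.Θ / d.r ^ 2 := by linarith
    rw [this, hmax]
    field_simp
    ring
  rw [h1, ← hgϑ] at hT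
  -- `hT : Θ s_ϑ DₜΘ = -(Θ p_ϑ) divU / r`
  field_simp at hT
  linear_combination hT

/-- The relative energy is non-negative (for `ρ, ϑ(ρ,E), r, Θ > 0`). [cite: BrezinaFeireisl2018, (3.8)] -/
theorem relEnergyFull_nonneg (hG : eos.IsGibbs) (hS : eos.IsThermodynamicallyStable)
    (d : StrongPointData) (hr : 0 < d.r) (hΘ : 0 < d.Θ) {ρ E : ℝ} (hρ : 0 < ρ)
    (hϑ : 0 < stateTemp eos ρ E) (m : EuclideanSpace ℝ (Fin 3)) :
    0 ≤ relEnergyFull eos d ρ E m := by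
  unfold relEnergyFull
  have := relEnergyThermo_nonneg hG hS hr hΘ hρ hϑ
  positivity

/-- **The uniform pointwise inequality** (BF (3.9)–(3.11) at the level of integrands): see the
module docstring. [cite: BrezinaFeireisl2018, §3.2.2 (3.11)] -/
theorem master_pointwise_inequality (hG : eos.IsGibbs) (hS : eos.IsThermodynamicallyStable)
    (hp2 : ContDiffOn ℝ 2 (uncurry eos.p) (Set.Ioi 0 ×ˢ Set.Ioi 0))
    (he2 : ContDiffOn ℝ 2 (uncurry eos.e) (Set.Ioi 0 ×ˢ Set.Ioi 0))
    (hs2 : ContDiffOn ℝ 2 (uncurry eos.s) (Set.Ioi 0 ×ˢ Set.Ioi 0))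
    (he : ∀ r θ : ℝ, 0 < r → 0 < θ → 0 < eos.e r θ)
    (hgrowth : ∃ c : ℝ, ∀ r θ : ℝ, 0 < r → 0 < θ →
      |eos.p r θ| ≤ c * (1 + r + r * |eos.s r θ| + r * eos.e r θ))
    {K : Set (ℝ × ℝ)} (hK : IsCompact K) (hKq : K ⊆ Set.Ioi 0 ×ˢ Set.Ioi 0) {M : ℝ} (hM : 0 ≤ M) :
    ∃ δ a b C : ℝ, 0 < δ ∧ a < b ∧ 0 < C ∧
      (∀ r Θ ρ ϑ : ℝ, (r, Θ) ∈ K → |ρ - r| ≤ δ → |ϑ - Θ| ≤ δ →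
        a ≤ eos.s ρ ϑ ∧ eos.s ρ ϑ ≤ b) ∧
      ∀ d : StrongPointData, (d.r, d.Θ) ∈ K → d.Bounded M → d.MassEq → d.TemperatureEq eos →
        ∀ (ρ E : ℝ) (m : EuclideanSpace ℝ (Fin 3)), 0 < ρ → 0 < stateTemp eos ρ E →
          reducedRHS eos (clamp a b) d ρ E m ≤ C * relEnergyFull eos d ρ E m := by
  -- Step 0: constants
  obtain ⟨δ₁, c₁, hδ₁, hc₁, hbox₁, hcoer₁⟩ := relEnergyThermo_coercivity_near_far hG hS hK hKq
  obtain ⟨Cd, hCd, hCd'⟩ := density_le_of_relEnergyThermo hG hS hK hKq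
  obtain ⟨Ce, hCe, hCe'⟩ := energy_entropy_le_of_relEnergyThermo hG hS he hK hKq
  obtain ⟨δ₂, hδ₂, hKδ₂⟩ := hK.exists_cthickening_subset_open isOpen_quadrant hKq
  obtain ⟨cg₀, hcg₀⟩ := hgrowth
  set δ := min δ₁ δ₂ with hδdef
  have hδ : 0 < δ := lt_min hδ₁ hδ₂
  have hδδ₁ : δ ≤ δ₁ := min_le_left _ _
  have hKδ : cthickening δ K ⊆ Set.Ioi 0 ×ˢ Set.Ioi 0 := (cthickening_mono (min_le_right _ _) K).trans hKδ₂
  obtain ⟨Lp, hLp0, hLp⟩ := taylor_bounds_near_compact hp2 isOpen_quadrant hK hKδ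
  obtain ⟨Ls, hLs0, hLs⟩ := taylor_bounds_near_compact hs2 isOpen_quadrant hK hKδ
  -- bounds on `K`
  obtain ⟨Pk, hPk0, hPk⟩ := exists_nonneg_forall_abs_le_of_continuousOn hK
    ((hG.1.continuousOn (s := Set.Ioi 0 ×ˢ Set.Ioi 0)).mono hKq)
  obtain ⟨S₀, hS₀0, hS₀⟩ := exists_nonneg_forall_abs_le_of_continuousOn hK
    ((hG.2.2.1.continuousOn (s := Set.Ioi 0 ×ˢ Set.Ioi 0)).mono hKq)
  obtain ⟨S₁, hS₁0, hS₁⟩ := exists_nonneg_forall_abs_le_of_continuousOn hK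
    ((continuousOn_deriv_slice_fst hG.1 isOpen_quadrant le_rfl).mono hKq)
  obtain ⟨S₂, hS₂0, hS₂⟩ := exists_nonneg_forall_abs_le_of_continuousOn hK
    ((continuousOn_deriv_slice_snd hG.1 isOpen_quadrant le_rfl).mono hKq)
  obtain ⟨S₃, hS₃0, hS₃⟩ := exists_nonneg_forall_abs_le_of_continuousOn hK
    ((continuousOn_deriv_slice_fst hG.2.2.1 isOpen_quadrant le_rfl).mono hKq)
  obtain ⟨S₄, hS₄0, hS₄⟩ := exists_nonneg_forall_abs_le_of_continuousOn hK
    ((continuousOn_deriv_slice_snd hG.2.2.1 isOpen_quadrant le_rfl).mono hKq)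
  obtain ⟨Sbox, hSbox0, hSbox⟩ := exists_nonneg_forall_abs_le_of_continuousOn hK.cthickening
    ((hG.2.2.1.continuousOn (s := Set.Ioi 0 ×ˢ Set.Ioi 0)).mono hKδ)
  obtain ⟨rmin, hrmin, hrminle⟩ :=
    hK.exists_forall_le' continuousOn_fst fun z hz => (hKq hz).1
  obtain ⟨ρmax, hρmax0, hρmax⟩ := exists_nonneg_forall_abs_le_of_continuousOn hK continuousOn_fst
  -- derived constants (opaque)
  obtain ⟨Sk, hSk1, hSk2, hSk3, hSk4, hSk5, hSk0⟩ : ∃ Sk : ℝ, S₀ ≤ Sk ∧ S₁ ≤ Sk ∧ S₂ ≤ Sk ∧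
      S₃ ≤ Sk ∧ S₄ ≤ Sk ∧ 0 ≤ Sk :=
    ⟨S₀ + S₁ + S₂ + S₃ + S₄, by linarith, by linarith, by linarith, by linarith, by linarith,
      by positivity⟩
  obtain ⟨L, hLp', hLs', hL0⟩ : ∃ L : ℝ, Lp ≤ L ∧ Ls ≤ L ∧ 0 ≤ L := ⟨Lp + Ls, by linarith,
    by linarith, by positivity⟩
  set a : ℝ := -Sbox - 1 with ha
  set b : ℝ := Sbox + 1 with hb
  have hab : a < b := by simp only [ha, hb]; linarith
  have hZb : ∀ x, |clamp a b x| ≤ max |a| |b| := abs_clamp_le hab.le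
  set cg : ℝ := max cg₀ 0 with hcg
  have hcg0 : 0 ≤ cg := le_max_right _ _
  set Cg : ℝ := max Cd Ce with hCg
  have hCg0 : 0 ≤ Cg := hCd.le.trans (le_max_left _ _)
  set c₀ : ℝ := min c₁ (c₁ * δ ^ 2) with hc₀
  have hc₀pos : 0 < c₀ := lt_min hc₁ (by positivity)
  set P : ℝ := ρmax + δ with hP
  -- the two constants and the final one
  set Cess : ℝ := 6 * M + 3 * L * M + (3 * M * L + 2 * Sk * (M + 3 * M * M) +
    P * L * (M + 3 * M * M) + L * M * P) / c₁ with hCess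
  set Cres : ℝ := 2 * (3 * M + (Sk + max |a| |b|) * M / 2) +
    ((3 * M * Pk + 3 * M * cg + 6 * M * cg * Cg) + 2 * Sk * (M + 3 * M * M) * (1 / rmin + 1) +
      (Sk + max |a| |b|) * (M + 3 * M * M) + 3 / 2 * (Sk + max |a| |b|) * M) *
      ((1 + Cg) * (1 / c₀ + 1)) with hCres
  set C : ℝ := max (max Cess Cres) 1 with hC
  have hCpos : 0 < C := lt_of_lt_of_le zero_lt_one (le_max_right _ _)
  have hCess_le : Cess ≤ C := (le_max_left _ _).trans (le_max_left _ _)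
  have hCres_le : Cres ≤ C := (le_max_right _ _).trans (le_max_left _ _)
  -- the entropy range on the boxes
  have hsbox : ∀ r Θ ρ ϑ : ℝ, (r, Θ) ∈ K → |ρ - r| ≤ δ → |ϑ - Θ| ≤ δ →
      a ≤ eos.s ρ ϑ ∧ eos.s ρ ϑ ≤ b := by
    intro r Θ ρ ϑ hrΘ hρ hϑ
    have hmem : (ρ, ϑ) ∈ cthickening δ K := mem_cthickening_of_abs_le hrΘ hρ hϑ
    have h := abs_le.1 (hSbox _ hmem)
    simp only [Function.uncurry_apply_pair] at h
    simp only [ha, hb]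
    constructor
    · linarith only [h.1]
    · linarith only [h.2]
  refine ⟨δ, a, b, C, hδ, hab, hCpos, hsbox, ?_⟩
  -- Step 1: the inequality
  intro d hdK hB hmass hTeq ρ E m hρ hϑ
  have hr : 0 < d.r := (hKq hdK).1
  have hΘ : 0 < d.Θ := (hKq hdK).2
  have hE0 := relEnergyFull_nonneg hG hS d hr hΘ hρ hϑ m
  by_cases hnear : |ρ - d.r| ≤ δ ∧ |stateTemp eos ρ E - d.Θ| ≤ δ
  · -- essential region
    have hsb := hsbox d.r d.Θ ρ (stateTemp eos ρ E) hdK hnear.1 hnear.2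
    have hZ : clamp a b (eos.s ρ (stateTemp eos ρ E)) = eos.s ρ (stateTemp eos ρ E) :=
      clamp_eq_self hsb.1 hsb.2
    have hMax := maxwell_form hG hp2 he2 hs2 d hr hΘ
    have hTemp := tempEq_entropy_form hG hp2 he2 hs2 d hr hΘ hTeq
    have hρP : ρ ≤ P := by
      have h1 := (abs_le.1 hnear.1).2
      have h2 : d.r ≤ ρmax := (le_abs_self _).trans (hρmax _ hdK)
      simp only [hP]; linarith only [h1, h2]
    have hq0 : 0 ≤ (ρ - d.r) ^ 2 + (stateTemp eos ρ E - d.Θ) ^ 2 := by positivity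
    have hpl := (hLp d.r d.Θ ρ (stateTemp eos ρ E) hdK hnear.1 hnear.2).2
    have hsl := (hLs d.r d.Θ ρ (stateTemp eos ρ E) hdK hnear.1 hnear.2)
    have hcoer := (hcoer₁ d.r d.Θ ρ (stateTemp eos ρ E) hdK hρ hϑ).1 (hnear.1.trans hδδ₁)
      (hnear.2.trans hδδ₁)
    have hess := reducedRHS_le_essential (Z := clamp a b) (m := m) hM hL0 hSk0 hc₁ hB hr hρ hρP
      hmass hZ hMax hTemp ((hS₃ _ hdK).trans hSk4) ((hS₄ _ hdK).trans hSk5)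
      (hpl.trans (mul_le_mul_of_nonneg_right hLp' hq0))
      (hsl.2.trans (mul_le_mul_of_nonneg_right hLs' hq0))
      (hsl.1.trans (mul_le_mul_of_nonneg_right hLs' (by positivity))) hcoer
    exact hess.trans (mul_le_mul_of_nonneg_right hCess_le hE0)
  · -- residual region
    have hfar : δ ≤ |ρ - d.r| ∨ δ ≤ |stateTemp eos ρ E - d.Θ| := by
      rcases not_and_or.1 hnear with h | h
      · exact Or.inl (le_of_lt (not_le.1 h))
      · exact Or.inr (le_of_lt (not_le.1 h))
    -- residual coercivity with the smaller `δ`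
    have hRc₀ : c₀ ≤ eos.relEnergyThermo d.r d.Θ ρ (stateTemp eos ρ E) := by
      have hcf := hcoer₁ d.r d.Θ ρ (stateTemp eos ρ E) hdK hρ hϑ
      by_cases hfar₁ : δ₁ ≤ |ρ - d.r| ∨ δ₁ ≤ |stateTemp eos ρ E - d.Θ|
      · exact (min_le_left _ _).trans (hcf.2 hfar₁)
      · rcases not_or.1 hfar₁ with ⟨h1, h2⟩
        have hloc := hcf.1 (le_of_lt (not_le.1 h1)) (le_of_lt (not_le.1 h2))
        refine (min_le_right _ _).trans (le_trans ?_ hloc)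
        refine mul_le_mul_of_nonneg_left ?_ hc₁.le
        rcases hfar with h | h
        · have h3 : δ ^ 2 ≤ (ρ - d.r) ^ 2 := by
            rw [← sq_abs (ρ - d.r)]; exact pow_le_pow_left₀ hδ.le h 2
          linarith only [h3, sq_nonneg (stateTemp eos ρ E - d.Θ)]
        · have h3 : δ ^ 2 ≤ (stateTemp eos ρ E - d.Θ) ^ 2 := by
            rw [← sq_abs (stateTemp eos ρ E - d.Θ)]; exact pow_le_pow_left₀ hδ.le h 2
          linarith only [h3, sq_nonneg (ρ - d.r)]
    have hgr : |eos.p ρ (stateTemp eos ρ E)| ≤ cg * (1 + ρ + ρ * |eos.s ρ (stateTemp eos ρ E)| +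
        ρ * eos.e ρ (stateTemp eos ρ E)) := by
      refine (hcg₀ ρ _ hρ hϑ).trans (mul_le_mul_of_nonneg_right (le_max_left _ _) ?_)
      have := he ρ _ hρ hϑ
      positivity
    have hρC : ρ ≤ Cg * (1 + eos.relEnergyThermo d.r d.Θ ρ (stateTemp eos ρ E)) :=
      (hCd' d.r d.Θ ρ _ hdK hρ hϑ).trans (mul_le_mul_of_nonneg_right (le_max_left _ _)
        (by linarith only [hc₀pos.le.trans hRc₀]))
    have hee := hCe' d.r d.Θ ρ _ hdK hρ hϑ
    have hsum0 : 0 ≤ 1 + ρ + eos.relEnergyThermo d.r d.Θ ρ (stateTemp eos ρ E) := by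
      linarith only [hc₀pos.le.trans hRc₀, hρ]
    have heC := hee.1.trans (mul_le_mul_of_nonneg_right (le_max_right Cd Ce) hsum0)
    have hsC := hee.2.trans (mul_le_mul_of_nonneg_right (le_max_right Cd Ce) hsum0)
    have hres := reducedRHS_le_residual (Z := clamp a b) (E := E) (m := m) hM hPk0 hSk0
      (le_max_of_le_left (abs_nonneg a) : 0 ≤ max |a| |b|) hcg0 hc₀pos hCg0 hrmin (hrminle _ hdK)
      hρ hB (hPk _ hdK) ((hS₀ _ hdK).trans hSk1) ((hS₁ _ hdK).trans hSk2)
      ((hS₂ _ hdK).trans hSk3) hZb hgr hRc₀ hρC heC hsC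
    exact hres.trans (mul_le_mul_of_nonneg_right hCres_le hE0)

end CompressibleEuler

end Literature.Analysis.FluidPDE
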